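import Literature.NumberTheory.Automorphic.MirabolicEisensteinMajorant
import Mathlib.Analysis.Normed.Group.FunctionSeries
import HarnessLib

/-!
# Continuity of the mirabolic Eisenstein series `g ↦ E(g, Φ; s)` on `re s > 1`

Topic `NumberTheory/Automorphic`; namespace `Literature.NumberTheory.Automorphic`. Proof file
(theorems only), sequel to `MirabolicEisensteinConvergence` / `MirabolicEisensteinMajorant`. On its
half-plane of absolute convergence the mirabolic Eisenstein series
`E(g, Φ; s) = |det g|^s ∑_{ξ ∈ ℙ^{n-1}(K)} ∫_{𝔸_Kˣ} Φ(a ξ g) |a|^{ns} dν(a)` (`mirabolicEisenstein`,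
Jacquet–Shalika (1981), §4; Cogdell (2004), §2.3) is a **continuous** function of `g ∈ GL_n(𝔸_K)`
(indeed smooth and of moderate growth; continuity is what makes `E` and the Rankin–Selberg
integrands measurable on the automorphic quotient):

* `continuous_tateVectorIntegral_and_tsum_of_isStandard` — for a standard Schwartz–Bruhat `Φ` and
  `re s > 1`, each Tate-type integral `g ↦ ∫ Φ(a ξ g) |a|^{ns} dν(a)` and their sum over
  `ξ ∈ ℙ^{n-1}(K)` are continuous: near `g₀` the translates `Φ(· g)`, `g` in a compact
  neighbourhood, are dominated by one radial majorant `Φ₀` (`exists_radialMajorant_of_isCompact`)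
  whose majorant series is finite (`tsum_lintegral_enorm_smul_lt_top_of_decay`) — dominated
  convergence for each integral (`continuousAt_of_dominated`) and the Weierstrass `M`-test for the
  sum (`continuousOn_tsum`);
* `continuous_tateVectorIntegral_and_tsum_of_mem` — the same for every `Φ ∈ 𝒮(𝔸_Kⁿ)` (linearity);
* `continuous_mirabolicEisenstein`, `continuous_mirabolicEisensteinQuot`,
  `measurable_mirabolicEisensteinQuot` — continuity of `E(·, Φ; s)` on `GL_n(𝔸_K)` and of its
  descent to `GL_n(𝔸_K) ⧸ A_G GL_n(K)`, hence Borel measurability there.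

Folklore (Godement–Jacquet, LNM 260 (1972), §11; Jacquet–Shalika (1981), §4).

## References

* H. Jacquet, J. A. Shalika, Amer. J. Math. 103 (1981), §4 [JacquetShalikaAJM1981].
* J. W. Cogdell, in *An Introduction to the Langlands Program* (2004), §2.3 [CogdellAnalyticTheory2004].
* R. Godement, H. Jacquet, *Zeta functions of simple algebras*, LNM 260 (1972), §11 [GodementJacquetLNM260].
-/

noncomputable section

open scoped NNReal ENNReal Pointwise Classical Topology
open NumberField NumberField.mixedEmbedding IsDedekindDomain Set MeasureTheory Measure Matrix Module Filter

namespace Literature.NumberTheory.Automorphic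

variable (K : Type) [Field K] [NumberField K] {n : ℕ}

/-! ### Small lemmas -/

/-- `g ↦ ξ g` is continuous on `GL_n(𝔸_K)`. [folklore] -/
theorem continuous_ratVec_vecMul (ξ : Fin n → K) :
    Continuous fun g : GL (Fin n) (AdeleRing (𝓞 K) K) =>
      ratVec K ξ ᵥ* (g : Matrix (Fin n) (Fin n) (AdeleRing (𝓞 K) K)) :=
  continuous_const.matrix_vecMul Units.continuous_val

/-- The norm of the Eisenstein kernel: `‖Φ(a x) |a|^{ns}‖ = |Φ(a x)| |a|^{n re s}`. [folklore] -/
theorem norm_eisensteinKernel (Φ : (Fin n → AdeleRing (𝓞 K) K) → ℂ) (s : ℂ)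
    (x : Fin n → AdeleRing (𝓞 K) K) (a : GaloisRepresentations.ideleGroup K) :
    ‖eisensteinKernel K Φ s x a‖ =
      ‖Φ ((a : AdeleRing (𝓞 K) K) • x)‖ * (IdeleClassGroup.ideleNorm K a : ℝ) ^ ((n : ℝ) * s.re) := by
  have ha : 0 < (IdeleClassGroup.ideleNorm K a : ℝ) :=
    NNReal.coe_pos.2 (pos_iff_ne_zero.2 (ideleNorm_ne_zero a))
  rw [eisensteinKernel, norm_mul, Complex.norm_cpow_eq_rpow_re_of_pos ha]
  congr 2
  simp [Complex.mul_re]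

/-! ### Standard `Φ`: dominated convergence near each point -/

/-- **Continuity of the Tate-type integrals and of their sum (standard `Φ`).** For a Haar measure
`ν` on `𝔸_Kˣ`, a standard Schwartz–Bruhat `Φ` and `re s > 1`: every
`g ↦ ∫ Φ(a ξ_p g) |a|^{ns} dν(a)` (`p ∈ ℙ^{n-1}(K)`) and `g ↦ ∑_p ∫ Φ(a ξ_p g) |a|^{ns} dν(a)` are
continuous on `GL_n(𝔸_K)`. Near `g₀`, on a compact neighbourhood `C₁`, the translates `Φ(· g)`,
`g ∈ C₁`, are dominated by one radial majorant `Φ₀` (`exists_radialMajorant_of_isCompact`) with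
`∑_p ∫ |Φ₀(a ξ_p)| |a|^{n re s} dν < ∞` (`tsum_lintegral_enorm_smul_lt_top_of_decay`); conclude by
dominated convergence (`continuousAt_of_dominated`) and the `M`-test (`continuousOn_tsum`).
[cite: GodementJacquetLNM260, §11] -/
theorem continuous_tateVectorIntegral_and_tsum_of_isStandard [MeasurableSpace (AdeleRing (𝓞 K) K)]
    [BorelSpace (AdeleRing (𝓞 K) K)] (ν : Measure (GaloisRepresentations.ideleGroup K)) [ν.IsHaarMeasure]
    {Φ : (Fin n → AdeleRing (𝓞 K) K) → ℂ} (hΦ : IsStandardSchwartzBruhat K n Φ) {s : ℂ} (hs : 1 < s.re) :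
    (∀ p : Projectivization K (Fin n → K), Continuous fun g : GL (Fin n) (AdeleRing (𝓞 K) K) =>
      tateVectorIntegral K ν Φ s (ratVec K p.rep ᵥ* (g : Matrix (Fin n) (Fin n) (AdeleRing (𝓞 K) K)))) ∧
    Continuous fun g : GL (Fin n) (AdeleRing (𝓞 K) K) => ∑' p : Projectivization K (Fin n → K),
      tateVectorIntegral K ν Φ s (ratVec K p.rep ᵥ* (g : Matrix (Fin n) (Fin n) (AdeleRing (𝓞 K) K))) := by
  haveI := borelSpace_ideleGroup K
  haveI : LocallyCompactSpace (GL (Fin n) (AdeleRing (𝓞 K) K)) :=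
    AdelicGroupData.locallyCompactSpace_generalLinearGroup_adeleRing K (Fin n)
  haveI : SecondCountableTopology (GL (Fin n) (AdeleRing (𝓞 K) K)) :=
    secondCountableTopology_generalLinearGroup_adeleRing K (Fin n)
  set σ : ℝ := s.re with hσ'
  have hσ : 1 < σ := hs
  -- decay and support of `Φ` to an order `k > n [K:ℚ] σ`
  set k : ℕ := ⌊(n : ℝ) * finrank ℚ K * σ⌋₊ + 1 with hk'
  have hk : (n : ℝ) * finrank ℚ K * σ < k := by
    rw [hk']
    push_cast
    exact Nat.lt_floor_add_one _
  obtain ⟨M, hM0, hM⟩ := hΦ.exists_norm_le_rpow_neg k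
  obtain ⟨Cf, hCfc, hCf⟩ := hΦ.exists_isCompact_eq_zero
  have hΦc : Continuous Φ := hΦ.continuous
  -- the kernel and its continuity / measurability
  set kern : Projectivization K (Fin n → K) → GL (Fin n) (AdeleRing (𝓞 K) K) →
      GaloisRepresentations.ideleGroup K → ℂ := fun p g =>
    eisensteinKernel K Φ s (ratVec K p.rep ᵥ* (g : Matrix (Fin n) (Fin n) (AdeleRing (𝓞 K) K))) with hkern
  have hkern_meas : ∀ p g, AEStronglyMeasurable (kern p g) ν := fun p g =>
    (continuous_eisensteinKernel K hΦc s _).aestronglyMeasurable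
  have hkern_cont : ∀ p a, Continuous fun g : GL (Fin n) (AdeleRing (𝓞 K) K) => kern p g a := by
    intro p a
    simp only [hkern, eisensteinKernel]
    exact (hΦc.comp ((continuous_const (y := (a : AdeleRing (𝓞 K) K))).smul
      (continuous_ratVec_vecMul K p.rep))).mul continuous_const
  -- local domination near a point `g₀`
  have hloc : ∀ g₀ : GL (Fin n) (AdeleRing (𝓞 K) K), ∃ C₁ ∈ 𝓝 g₀,
      ∃ (bound : Projectivization K (Fin n → K) → GaloisRepresentations.ideleGroup K → ℝ)
        (u : Projectivization K (Fin n → K) → ℝ),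
        (∀ p, Integrable (bound p) ν) ∧ Summable u ∧
        (∀ p, ∀ g ∈ C₁, ∀ a, ‖kern p g a‖ ≤ bound p a) ∧
        (∀ p, ∫ a, bound p a ∂ν ≤ u p) := by
    intro g₀
    obtain ⟨C₁, hC₁c, hC₁n⟩ := exists_compact_mem_nhds g₀
    obtain ⟨M', Cf', hM'0, hCf'c, hCf'cl, hdom⟩ :=
      exists_radialMajorant_of_isCompact K hM0 hM hCfc hCf hC₁c
    -- the radial majorant `Φ₀` and its finite majorant series
    set Φ₀ : (Fin n → AdeleRing (𝓞 K) K) → ℂ := fun y =>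
      (((M' * (1 + ‖vecInfinitePart K n y‖) ^ (-(k : ℝ)) *
        Cf'.indicator (fun _ => (1 : ℝ)) (vecFinitePart K n y) : ℝ) : ℂ)) with hΦ₀
    have hmeas₀ : ∀ x : Fin n → AdeleRing (𝓞 K) K, Measurable fun a : GaloisRepresentations.ideleGroup K =>
        (‖Φ₀ ((a : AdeleRing (𝓞 K) K) • x)‖ₑ : ℝ≥0∞) :=
      fun x => measurable_enorm_radialMajorant_smul K M' k hCf'cl x
    have hM₀ : ∀ y, ‖Φ₀ y‖ ≤ M' * (1 + ‖vecInfinitePart K n y‖) ^ (-(k : ℝ)) :=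
      fun y => norm_radialMajorant_le hM'0 k Cf' y
    have hCf₀ : ∀ y, vecFinitePart K n y ∉ Cf' → Φ₀ y = 0 := fun y hy => radialMajorant_eq_zero M' k hy
    have hfin := tsum_lintegral_enorm_smul_lt_top_of_decay K ν
      (1 : GL (Fin n) (AdeleRing (𝓞 K) K)) hmeas₀ hM'0 hM₀ hCf'c hCf₀ hσ hk
    simp only [Matrix.GeneralLinearGroup.coe_one, Matrix.vecMul_one] at hfin
    set U : Projectivization K (Fin n → K) → ℝ≥0∞ := fun p =>
      ∫⁻ a, (‖Φ₀ ((a : AdeleRing (𝓞 K) K) • ratVec K p.rep)‖ₑ : ℝ≥0∞) *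
        ENNReal.ofReal ((IdeleClassGroup.ideleNorm K a : ℝ) ^ ((n : ℝ) * σ)) ∂ν with hU
    have hUfin : ∀ p, U p < ⊤ := fun p => lt_of_le_of_lt (ENNReal.le_tsum p) hfin
    -- the dominating functions
    set bound : Projectivization K (Fin n → K) → GaloisRepresentations.ideleGroup K → ℝ := fun p a =>
      ‖Φ₀ ((a : AdeleRing (𝓞 K) K) • ratVec K p.rep)‖ *
        (IdeleClassGroup.ideleNorm K a : ℝ) ^ ((n : ℝ) * σ) with hbound
    have hbound_nn : ∀ p a, 0 ≤ bound p a := fun p a =>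
      mul_nonneg (norm_nonneg _) (Real.rpow_nonneg (NNReal.coe_nonneg _) _)
    have hbound_enorm : ∀ p a, (‖bound p a‖ₑ : ℝ≥0∞) =
        (‖Φ₀ ((a : AdeleRing (𝓞 K) K) • ratVec K p.rep)‖ₑ : ℝ≥0∞) *
          ENNReal.ofReal ((IdeleClassGroup.ideleNorm K a : ℝ) ^ ((n : ℝ) * σ)) := by
      intro p a
      rw [Real.enorm_eq_ofReal (hbound_nn p a), hbound, ENNReal.ofReal_mul (norm_nonneg _), ofReal_norm]
    have hc : Continuous fun a : GaloisRepresentations.ideleGroup K =>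
        (IdeleClassGroup.ideleNorm K a : ℝ) ^ ((n : ℝ) * σ) :=
      (NNReal.continuous_coe.comp (continuous_ideleNorm_holds K)).rpow_const fun a =>
        Or.inl (NNReal.coe_ne_zero.2 (ideleNorm_ne_zero a))
    have hbound_meas : ∀ p, AEStronglyMeasurable (bound p) ν := by
      intro p
      have h1 : Measurable fun a : GaloisRepresentations.ideleGroup K =>
          ‖Φ₀ ((a : AdeleRing (𝓞 K) K) • ratVec K p.rep)‖ := by
        simpa only [toReal_enorm] using (hmeas₀ (ratVec K p.rep)).ennreal_toReal
      exact (h1.mul hc.measurable).aestronglyMeasurable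
    have hbound_int : ∀ p, Integrable (bound p) ν := fun p =>
      ⟨hbound_meas p, by
        change ∫⁻ a, ‖bound p a‖ₑ ∂ν < ⊤
        simp_rw [hbound_enorm]
        exact hUfin p⟩
    have hbound_integral : ∀ p, ∫ a, bound p a ∂ν = (U p).toReal := by
      intro p
      rw [integral_eq_lintegral_of_nonneg_ae (Eventually.of_forall (hbound_nn p)) (hbound_meas p)]
      congr 1
      refine lintegral_congr fun a => ?_
      rw [← Real.enorm_eq_ofReal (hbound_nn p a), hbound_enorm]
    -- domination of the kernels on `C₁`
    have hdom' : ∀ p, ∀ g ∈ C₁, ∀ a, ‖kern p g a‖ ≤ bound p a := by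
      intro p g hg a
      simp only [hkern, hbound]
      rw [norm_eisensteinKernel, ← Matrix.smul_vecMul]
      exact mul_le_mul_of_nonneg_right (hdom g hg _) (Real.rpow_nonneg (NNReal.coe_nonneg _) _)
    refine ⟨C₁, hC₁n, bound, fun p => (U p).toReal, hbound_int, ENNReal.summable_toReal hfin.ne,
      hdom', fun p => (hbound_integral p).le⟩
  -- (i) each Tate-type integral is continuous
  have hT : ∀ p : Projectivization K (Fin n → K), Continuous fun g : GL (Fin n) (AdeleRing (𝓞 K) K) =>
      tateVectorIntegral K ν Φ s (ratVec K p.rep ᵥ* (g : Matrix (Fin n) (Fin n) (AdeleRing (𝓞 K) K))) := by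
    intro p
    refine continuous_iff_continuousAt.2 fun g₀ => ?_
    obtain ⟨C₁, hC₁n, bound, u, hbi, -, hdom', -⟩ := hloc g₀
    change ContinuousAt (fun g => ∫ a, kern p g a ∂ν) g₀
    exact continuousAt_of_dominated (Eventually.of_forall (hkern_meas p))
      (Filter.eventually_of_mem hC₁n fun g hg => Eventually.of_forall (hdom' p g hg)) (hbi p)
      (Eventually.of_forall fun a => (hkern_cont p a).continuousAt)
  refine ⟨hT, ?_⟩
  -- (ii) the sum is continuous: `M`-test on a neighbourhood of each point
  refine continuous_iff_continuousAt.2 fun g₀ => ?_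
  obtain ⟨C₁, hC₁n, bound, u, hbi, hu, hdom', hint⟩ := hloc g₀
  have hOn : ContinuousOn (fun g : GL (Fin n) (AdeleRing (𝓞 K) K) => ∑' p : Projectivization K (Fin n → K),
      tateVectorIntegral K ν Φ s (ratVec K p.rep ᵥ* (g : Matrix (Fin n) (Fin n) (AdeleRing (𝓞 K) K)))) C₁ := by
    refine continuousOn_tsum (fun p => (hT p).continuousOn) hu fun p g hg => ?_
    change ‖∫ a, kern p g a ∂ν‖ ≤ u p
    calc ‖∫ a, kern p g a ∂ν‖ ≤ ∫ a, ‖kern p g a‖ ∂ν := norm_integral_le_integral_norm _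
      _ ≤ ∫ a, bound p a ∂ν :=
          integral_mono_of_nonneg (Eventually.of_forall fun a => norm_nonneg _) (hbi p)
            (Eventually.of_forall (hdom' p g hg))
      _ ≤ u p := hint p
  exact hOn.continuousAt hC₁n

/-! ### All of `𝒮(𝔸_Kⁿ)`: linearity -/

/-- The Eisenstein kernel is additive in `Φ`. [folklore] -/
theorem eisensteinKernel_add (Φ Ψ : (Fin n → AdeleRing (𝓞 K) K) → ℂ) (s : ℂ)
    (x : Fin n → AdeleRing (𝓞 K) K) (a : GaloisRepresentations.ideleGroup K) :
    eisensteinKernel K (Φ + Ψ) s x a = eisensteinKernel K Φ s x a + eisensteinKernel K Ψ s x a := by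
  simp only [eisensteinKernel, Pi.add_apply, add_mul]

/-- The Eisenstein kernel is homogeneous in `Φ`. [folklore] -/
theorem eisensteinKernel_smul (c : ℂ) (Φ : (Fin n → AdeleRing (𝓞 K) K) → ℂ) (s : ℂ)
    (x : Fin n → AdeleRing (𝓞 K) K) (a : GaloisRepresentations.ideleGroup K) :
    eisensteinKernel K (c • Φ) s x a = c * eisensteinKernel K Φ s x a := by
  simp only [eisensteinKernel, Pi.smul_apply, smul_eq_mul, mul_assoc]

/-- **Continuity of the Tate-type integrals and of their sum for every `Φ ∈ 𝒮(𝔸_Kⁿ)`**,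
`re s > 1` (linearity in `Φ` over `continuous_tateVectorIntegral_and_tsum_of_isStandard`; the
integrals are additive on `𝒮(𝔸_Kⁿ)` by `summable_mirabolicEisenstein_holds`). [folklore] -/
theorem continuous_tateVectorIntegral_and_tsum_of_mem [MeasurableSpace (AdeleRing (𝓞 K) K)]
    [BorelSpace (AdeleRing (𝓞 K) K)] (ν : Measure (GaloisRepresentations.ideleGroup K)) [ν.IsHaarMeasure]
    {Φ : (Fin n → AdeleRing (𝓞 K) K) → ℂ} (hΦ : Φ ∈ adelicSchwartzBruhat K n) {s : ℂ} (hs : 1 < s.re) :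
    (∀ p : Projectivization K (Fin n → K), Continuous fun g : GL (Fin n) (AdeleRing (𝓞 K) K) =>
      tateVectorIntegral K ν Φ s (ratVec K p.rep ᵥ* (g : Matrix (Fin n) (Fin n) (AdeleRing (𝓞 K) K)))) ∧
    Continuous fun g : GL (Fin n) (AdeleRing (𝓞 K) K) => ∑' p : Projectivization K (Fin n → K),
      tateVectorIntegral K ν Φ s (ratVec K p.rep ᵥ* (g : Matrix (Fin n) (Fin n) (AdeleRing (𝓞 K) K))) := by
  haveI := borelSpace_ideleGroup K
  induction hΦ using Submodule.span_induction with
  | mem Φ hΦ => exact continuous_tateVectorIntegral_and_tsum_of_isStandard K ν hΦ hs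
  | zero =>
      have h0 : ∀ x : Fin n → AdeleRing (𝓞 K) K,
          tateVectorIntegral K ν (0 : (Fin n → AdeleRing (𝓞 K) K) → ℂ) s x = 0 := fun x => by
        simp [tateVectorIntegral, eisensteinKernel]
      simp only [h0, tsum_zero]
      exact ⟨fun _ => continuous_const, continuous_const⟩
  | add Φ Ψ hΦm hΨm hΦ hΨ =>
      have hadd : ∀ g : GL (Fin n) (AdeleRing (𝓞 K) K), ∀ p : Projectivization K (Fin n → K),
          tateVectorIntegral K ν (Φ + Ψ) s
              (ratVec K p.rep ᵥ* (g : Matrix (Fin n) (Fin n) (AdeleRing (𝓞 K) K))) =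
            tateVectorIntegral K ν Φ s (ratVec K p.rep ᵥ* (g : Matrix (Fin n) (Fin n) (AdeleRing (𝓞 K) K))) +
            tateVectorIntegral K ν Ψ s (ratVec K p.rep ᵥ* (g : Matrix (Fin n) (Fin n) (AdeleRing (𝓞 K) K))) := by
        intro g p
        simp only [tateVectorIntegral, eisensteinKernel_add]
        exact integral_add ((summable_mirabolicEisenstein_holds K (n := n) ν Φ hΦm s hs g).1 p)
          ((summable_mirabolicEisenstein_holds K (n := n) ν Ψ hΨm s hs g).1 p)
      refine ⟨fun p => ?_, ?_⟩
      · simp only [hadd]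
        exact (hΦ.1 p).add (hΨ.1 p)
      · have htsum : ∀ g : GL (Fin n) (AdeleRing (𝓞 K) K),
            (∑' p : Projectivization K (Fin n → K), tateVectorIntegral K ν (Φ + Ψ) s
              (ratVec K p.rep ᵥ* (g : Matrix (Fin n) (Fin n) (AdeleRing (𝓞 K) K)))) =
            (∑' p : Projectivization K (Fin n → K), tateVectorIntegral K ν Φ s
              (ratVec K p.rep ᵥ* (g : Matrix (Fin n) (Fin n) (AdeleRing (𝓞 K) K)))) +
            ∑' p : Projectivization K (Fin n → K), tateVectorIntegral K ν Ψ s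
              (ratVec K p.rep ᵥ* (g : Matrix (Fin n) (Fin n) (AdeleRing (𝓞 K) K))) := by
          intro g
          simp only [hadd]
          exact (summable_tateVectorIntegral (summable_mirabolicEisenstein_holds K) ν hΦm hs g).tsum_add
            (summable_tateVectorIntegral (summable_mirabolicEisenstein_holds K) ν hΨm hs g)
        simp only [htsum]
        exact hΦ.2.add hΨ.2
  | smul c Φ hΦm hΦ =>
      have hsmul : ∀ x : Fin n → AdeleRing (𝓞 K) K,
          tateVectorIntegral K ν (c • Φ) s x = c * tateVectorIntegral K ν Φ s x := fun x => by
        simp only [tateVectorIntegral, eisensteinKernel_smul]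
        exact integral_const_mul c _
      refine ⟨fun p => ?_, ?_⟩
      · simp only [hsmul]
        exact continuous_const.mul (hΦ.1 p)
      · simp only [hsmul, tsum_mul_left]
        exact continuous_const.mul hΦ.2

/-! ### The Eisenstein series and its descent -/

/-- **`g ↦ E(g, Φ; s)` is continuous on `GL_n(𝔸_K)`** for `Φ ∈ 𝒮(𝔸_Kⁿ)` and `re s > 1`
(`|det g|^s` is continuous and the series of Tate-type integrals is,
`continuous_tateVectorIntegral_and_tsum_of_mem`). [cite: JacquetShalikaAJM1981, §4] -/
theorem continuous_mirabolicEisenstein [MeasurableSpace (AdeleRing (𝓞 K) K)]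
    [BorelSpace (AdeleRing (𝓞 K) K)] (ν : Measure (GaloisRepresentations.ideleGroup K)) [ν.IsHaarMeasure]
    {Φ : (Fin n → AdeleRing (𝓞 K) K) → ℂ} (hΦ : Φ ∈ adelicSchwartzBruhat K n) {s : ℂ} (hs : 1 < s.re) :
    Continuous (mirabolicEisenstein K ν Φ s) := by
  have hdet : Continuous fun g : GL (Fin n) (AdeleRing (𝓞 K) K) =>
      (((IdeleClassGroup.ideleNorm K (Matrix.GeneralLinearGroup.det g) : ℝ) : ℂ)) ^ s := by
    refine Continuous.cpow ?_ continuous_const fun g => Complex.ofReal_mem_slitPlane.2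
      (NNReal.coe_pos.2 (pos_iff_ne_zero.2 (ideleNorm_ne_zero _)))
    exact Complex.continuous_ofReal.comp (NNReal.continuous_coe.comp
      ((continuous_ideleNorm_holds K).comp Matrix.GeneralLinearGroup.continuous_det))
  exact hdet.mul (continuous_tateVectorIntegral_and_tsum_of_mem K ν hΦ hs).2

/-- **The descended Eisenstein series `E_X` is continuous** on `GL_n(𝔸_K) ⧸ A_G GL_n(K)`
(quotient topology; `x ↦ E(x⁻¹)` is continuous). [folklore] -/
theorem continuous_mirabolicEisensteinQuot [MeasurableSpace (AdeleRing (𝓞 K) K)]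
    [BorelSpace (AdeleRing (𝓞 K) K)] (ν : Measure (GaloisRepresentations.ideleGroup K)) [ν.IsHaarMeasure]
    [ν.IsMulRightInvariant] {Φ : (Fin n → AdeleRing (𝓞 K) K) → ℂ} (hΦ : Φ ∈ adelicSchwartzBruhat K n)
    {s : ℂ} (hs : 1 < s.re) :
    Continuous (mirabolicEisensteinQuot (K := K) ν Φ s) := by
  have h : Continuous fun x : GL (Fin n) (AdeleRing (𝓞 K) K) =>
      mirabolicEisenstein K ν Φ s (x⁻¹ : GL (Fin n) (AdeleRing (𝓞 K) K)) :=
    (continuous_mirabolicEisenstein K ν hΦ hs).comp continuous_inv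
  exact h.quotient_lift _

/-- **`E_X` is Borel measurable** on the automorphic quotient (for its Borel σ-algebra). [folklore] -/
theorem measurable_mirabolicEisensteinQuot [MeasurableSpace (AdeleRing (𝓞 K) K)]
    [BorelSpace (AdeleRing (𝓞 K) K)] (ν : Measure (GaloisRepresentations.ideleGroup K)) [ν.IsHaarMeasure]
    [ν.IsMulRightInvariant] {Φ : (Fin n → AdeleRing (𝓞 K) K) → ℂ} (hΦ : Φ ∈ adelicSchwartzBruhat K n)
    {s : ℂ} (hs : 1 < s.re) :
    Measurable (mirabolicEisensteinQuot (K := K) ν Φ s) :=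
  (continuous_mirabolicEisensteinQuot K ν hΦ hs).measurable

end Literature.NumberTheory.Automorphic
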